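import Summits.CriticalPhenomena.PercolationContinuityZ3.Theorems.PercNearOneGluingAdditiveGluingSetObserverCondAssoc
import Summits.CriticalPhenomena.PercolationContinuityZ3.Theorems.PercNearOneGluingAdditiveGluingSandwichLemma3
import HarnessLib

/-!
# Sandwich BHK for a SET observer — V: Kozma–Nitzan's Lemma 3 for every sandwich event of the cluster of an observer SET

Crux `PercNearOneGluing.AdditiveGluing` (stmt-CriticalPhenomena-4576), stub `stub_goodStep` (stub-plan prover; the
two-relay drift theorem = `stub_blockGoodTwo` at `A.card = 3` is the block-observer version of seat k41's two-relay
goodness, whose kernel is this lemma with the block as observer set).  Lands `--supports` the crux; no definitions,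
no named facts.

* `lemma3_sandwich_set` (**Corollary L3 for an observer set**): let `a₁, a₂, b` be vertices, `O` a finite set of
  vertices with cluster `K_O(ω) = ⋃_{o ∈ O} C(o)` (a set of VERTICES), and `Q = {K_O ∈ 𝓕}` for a family `𝓕` with
  `{a₂ ∈ K_O, a₁ ∉ K_O} ⊆ Q ⊆ {a₁ ∉ K_O}`.  If `μ(a₁ ↔ b) ≤ μ(a₂ ↔ b)` then `μ({a₁ ↔ b} ∩ Q) ≤ μ({a₂ ↔ b} ∩ Q)`.
  Proof: on `D = {a₁ ↮ a₂}`, `1{a₂ ↔ b}` is positively correlated with `1_Q` — the CUT sandwich function `ĝ` of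
  `(s,t) = (a₂,a₁)` with `h = 1_𝓕` is exactly `1_Q` (part IV `sandwich_condAssoc_set_hat`) — and `1{a₁ ↔ b}` is
  positively correlated with `1 − 1_Q` — the set sandwich function `g` of `(s,t) = (a₁,a₂)` with `h = 1 − 1_𝓕` is
  exactly `1 − 1_Q` (`sandwich_condAssoc_set`); chain through `μ(D, a₁↔b) ≤ μ(D, a₂↔b)` and add the common part on
  `{a₁ ↔ a₂}` (for a set observer the two sandwich functions are genuinely different: `{a₁ ↔ O ↔ a₂} ∩ D ≠ ∅`).
[cite: KozmaNitzan2024, Lemma 3 (pp. 6–7); VandenbergHaggstromKahn2005, Thms. 1.1–1.5]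
-/

noncomputable section

open MeasureTheory unitInterval
open Literature.Probability.LatticeModels (prodBernoulli)
open Literature.Probability.Percolation
open Literature.Probability.Percolation.BHK2006

namespace Summit.CriticalPhenomena.PercolationContinuityZ3.Theorems

namespace SandwichSet

variable {V : Type*} [Fintype V]

omit [Fintype V] in
/-- The vertex set `⋃_{o∈O} C(o)` of an observer set read off the union of its open EDGE clusters:
`v ∈ K_O ↔ ∃ o ∈ O, v = o ∨ v` lies on an edge of `⋃_{o∈O} C_o`. [cite: VandenbergHaggstromKahn2005, §1 p. 3] -/
theorem vertices_of_kUnion (ω : BondConfig V) (O : Finset V) :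
    {v | ∃ o ∈ O, v = o ∨ ∃ e ∈ (⋃ o' ∈ O, openEdgeCluster ω o'), v ∈ e} = ⋃ o ∈ O, openCluster ω o := by
  ext v
  simp only [Set.mem_setOf_eq, Set.mem_iUnion, exists_prop]
  constructor
  · rintro ⟨o, ho, hv | ⟨e, ⟨o', ho', he⟩, hve⟩⟩
    · exact ⟨o, ho, hv ▸ mem_openCluster_self ω o⟩
    · exact ⟨o', ho', (reachable_iff_exists_mem_openEdgeCluster ω o' v).2 (Or.inr ⟨e, he, hve⟩)⟩
  · rintro ⟨o, ho, hv⟩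
    rcases (reachable_iff_exists_mem_openEdgeCluster ω o v).1 hv with hv' | ⟨e, he, hve⟩
    · exact ⟨o, ho, Or.inl hv'⟩
    · exact ⟨o, ho, Or.inr ⟨e, ⟨o, ho, he⟩, hve⟩⟩

omit [Fintype V] in
/-- `a ∈ ⋃_{o∈O} C(o) ↔ ∃ o ∈ O, o ↔ a`. [folklore] -/
theorem mem_kUnion_iff (ω : BondConfig V) (O : Finset V) (a : V) :
    (a ∈ ⋃ o ∈ O, openCluster ω o) ↔ ∃ o ∈ O, (openGraph ω).Reachable o a := by
  simp only [Set.mem_iUnion, exists_prop]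
  exact Iff.rfl

open scoped Classical in
/-- **Corollary L3 for an observer SET (Kozma–Nitzan's Lemma 3 for every sandwich event of `K_O = ⋃_{o∈O} C(o)`).**
If `μ(a₁ ↔ b) ≤ μ(a₂ ↔ b)` and `𝓕` contains every value of `K_O` containing `a₂` but not `a₁` and no value containing
`a₁`, then `μ({a₁ ↔ b} ∩ {K_O ∈ 𝓕}) ≤ μ({a₂ ↔ b} ∩ {K_O ∈ 𝓕})`.  See the module docstring for the proof.
[cite: KozmaNitzan2024, Lemma 3 (pp. 6–7); VandenbergHaggstromKahn2005, Thms. 1.3–1.5] -/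
theorem lemma3_sandwich_set (w : Sym2 V → unitInterval) (a₁ a₂ b : V) (O : Finset V) (𝓕 : Set (Set V))
    (hlo : ∀ ω : BondConfig V, a₂ ∈ (⋃ o ∈ O, openCluster ω o) → a₁ ∉ (⋃ o ∈ O, openCluster ω o) →
      (⋃ o ∈ O, openCluster ω o) ∈ 𝓕)
    (hhi : ∀ ω : BondConfig V, (⋃ o ∈ O, openCluster ω o) ∈ 𝓕 → a₁ ∉ (⋃ o ∈ O, openCluster ω o))
    (hτ : (prodBernoulli w).real (openConn a₁ b) ≤ (prodBernoulli w).real (openConn a₂ b)) :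
    (prodBernoulli w).real (openConn a₁ b ∩ {ω | (⋃ o ∈ O, openCluster ω o) ∈ 𝓕}) ≤
      (prodBernoulli w).real (openConn a₂ b ∩ {ω | (⋃ o ∈ O, openCluster ω o) ∈ 𝓕}) := by
  set μ := prodBernoulli w with hμ
  set Q : Set (BondConfig V) := {ω | (⋃ o ∈ O, openCluster ω o) ∈ 𝓕} with hQ
  set D : Set (BondConfig V) := (openConn a₁ a₂)ᶜ with hD
  have hms : ∀ s : Set (BondConfig V), MeasurableSet s := fun s => (Set.toFinite s).measurableSet
  set h : Set (Sym2 V) → ℝ := fun C => if {v | ∃ o ∈ O, v = o ∨ ∃ e ∈ C, v ∈ e} ∈ 𝓕 then 1 else 0 with hh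
  have h0 : ∀ C, 0 ≤ h C := fun C => by simp only [hh]; split_ifs <;> norm_num
  have h1 : ∀ C, h C ≤ 1 := fun C => by simp only [hh]; split_ifs <;> norm_num
  have hhQ : ∀ ω, h (⋃ o ∈ O, openEdgeCluster ω o) = Q.indicator 1 ω := fun ω => by
    simp only [hh, vertices_of_kUnion]
    by_cases hω : ω ∈ Q
    · rw [Set.indicator_of_mem hω, Pi.one_apply, if_pos (show (⋃ o ∈ O, openCluster ω o) ∈ 𝓕 from hω)]
    · rw [Set.indicator_of_notMem hω, if_neg (show (⋃ o ∈ O, openCluster ω o) ∉ 𝓕 from hω)]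
  -- the cut sandwich function of `(a₂, a₁)` with `h = 1_𝓕` is `1_Q` (everywhere)
  have hg2 : ∀ ω : BondConfig V,
      (if ∃ o ∈ O, (openGraph ω).Reachable o a₁ then (0 : ℝ)
        else if ∃ o ∈ O, (openGraph ω).Reachable a₂ o then 1 else h (⋃ o ∈ O, openEdgeCluster ω o)) =
        Q.indicator 1 ω := by
    intro ω
    by_cases h1K : ∃ o ∈ O, (openGraph ω).Reachable o a₁
    · have hnm : ω ∉ Q := fun hq => hhi ω hq ((mem_kUnion_iff ω O a₁).2 h1K)
      rw [if_pos h1K, Set.indicator_of_notMem hnm]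
    · rw [if_neg h1K]
      by_cases h2K : ∃ o ∈ O, (openGraph ω).Reachable a₂ o
      · have hmem : ω ∈ Q := hlo ω ((mem_kUnion_iff ω O a₂).2 (h2K.imp fun o ⟨ho, hr⟩ => ⟨ho, hr.symm⟩))
          (fun h' => h1K ((mem_kUnion_iff ω O a₁).1 h'))
        rw [if_pos h2K, Set.indicator_of_mem hmem, Pi.one_apply]
      · rw [if_neg h2K, hhQ]
  -- the set sandwich function of `(a₁, a₂)` with `h' = 1 − 1_𝓕` is `1 − 1_Q` (everywhere)
  have hg1 : ∀ ω : BondConfig V,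
      (if ∃ o ∈ O, (openGraph ω).Reachable a₁ o then (1 : ℝ)
        else if ∃ o ∈ O, (openGraph ω).Reachable o a₂ then 0
          else (1 - h (⋃ o ∈ O, openEdgeCluster ω o))) = 1 - Q.indicator 1 ω := by
    intro ω
    by_cases h1K : ∃ o ∈ O, (openGraph ω).Reachable a₁ o
    · have hnm : ω ∉ Q := fun hq => hhi ω hq ((mem_kUnion_iff ω O a₁).2
        (h1K.imp fun o ⟨ho, hr⟩ => ⟨ho, hr.symm⟩))
      rw [if_pos h1K, Set.indicator_of_notMem hnm]; ring
    · rw [if_neg h1K]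
      by_cases h2K : ∃ o ∈ O, (openGraph ω).Reachable o a₂
      · have hmem : ω ∈ Q := hlo ω ((mem_kUnion_iff ω O a₂).2 h2K)
          (fun h' => h1K (((mem_kUnion_iff ω O a₁).1 h').imp fun o ⟨ho, hr⟩ => ⟨ho, hr.symm⟩))
        rw [if_pos h2K, Set.indicator_of_mem hmem, Pi.one_apply]; ring
      · rw [if_neg h2K, hhQ]
  -- the two `D`'s
  have hD2 : {ω : BondConfig V | ¬ (openGraph ω).Reachable a₂ a₁} = D := by
    ext ω
    simp only [hD, Set.mem_setOf_eq, Set.mem_compl_iff]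
    exact ⟨fun h' h'' => h' (show (openGraph ω).Reachable a₁ a₂ from h'').symm,
      fun h' h'' => h' (show ω ∈ openConn a₁ a₂ from h''.symm)⟩
  have hD1 : {ω : BondConfig V | ¬ (openGraph ω).Reachable a₁ a₂} = D := rfl
  have hInd : ∀ S T : Set (BondConfig V),
      ∫ ω in S, T.indicator (1 : BondConfig V → ℝ) ω ∂μ = μ.real (S ∩ T) := by
    intro S T
    rw [← integral_indicator (hms S), Set.indicator_indicator, integral_indicator_one (hms _)]
  have hF : ∀ (a : V) (S : Set (BondConfig V)),
      ∫ ω in S, connIndicatorFn a b (openEdgeCluster ω a) ∂μ = μ.real (S ∩ openConn a b) := by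
    intro a S
    simp_rw [connIndicatorFn_openEdgeCluster]
    exact hInd S _
  have hmul : ∀ (S T : Set (BondConfig V)) (ω : BondConfig V),
      S.indicator (1 : BondConfig V → ℝ) ω * T.indicator 1 ω = (S ∩ T).indicator 1 ω := by
    intro S T ω
    rw [Set.inter_indicator_one, Pi.mul_apply]
  -- Corollary H (cut) for `(s, t) = (a₂, a₁)`, `h = 1_𝓕`
  have hI := sandwich_condAssoc_set_hat w a₂ a₁ O (connIndicatorFn a₂ b) (monotone_connIndicatorFn a₂ b) h h0 h1
  simp_rw [hg2] at hI
  simp_rw [connIndicatorFn_openEdgeCluster, hmul] at hI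
  rw [hInd, hInd, hInd, hD2] at hI
  -- Corollary H for `(s, t) = (a₁, a₂)`, `h' = 1 - 1_𝓕`
  have hJ := sandwich_condAssoc_set w a₁ a₂ O (connIndicatorFn a₁ b) (monotone_connIndicatorFn a₁ b)
    (fun C => 1 - h C) (fun C => sub_nonneg.2 (h1 C)) (fun C => by linarith [h0 C])
  simp_rw [hg1] at hJ
  have hJ' : ∫ ω in {ω : BondConfig V | ¬ (openGraph ω).Reachable a₁ a₂},
      connIndicatorFn a₁ b (openEdgeCluster ω a₁) * (1 - Q.indicator 1 ω) ∂μ =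
      μ.real (D ∩ openConn a₁ b) - μ.real (D ∩ (openConn a₁ b ∩ Q)) := by
    simp_rw [mul_sub, mul_one, connIndicatorFn_openEdgeCluster, hmul]
    rw [integral_sub Integrable.of_finite Integrable.of_finite, hInd, hInd, hD1]
  have hJ'' : ∫ ω in {ω : BondConfig V | ¬ (openGraph ω).Reachable a₁ a₂},
      (1 - Q.indicator 1 ω) ∂μ = μ.real D - μ.real (D ∩ Q) := by
    rw [integral_sub Integrable.of_finite Integrable.of_finite, hInd, hD1]
    have : ∫ ω in D, (1 : ℝ) ∂μ = μ.real D := by rw [setIntegral_const, smul_eq_mul, mul_one]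
    rw [this]
  rw [hJ', hJ'', hF, hD1] at hJ
  -- the relay hypothesis on `D`, and the common part on `Dᶜ`
  have hτ' : μ.real (D ∩ openConn a₁ b) ≤ μ.real (D ∩ openConn a₂ b) := by
    have e := real_inter_openConn_sub_eq μ a₁ a₂ b Set.univ
    simp only [Set.univ_inter] at e
    rw [Set.inter_comm D, Set.inter_comm D, hD]
    linarith
  have hfin : μ.real (openConn a₁ b ∩ Q) - μ.real (openConn a₂ b ∩ Q) =
      μ.real (D ∩ (openConn a₁ b ∩ Q)) - μ.real (D ∩ (openConn a₂ b ∩ Q)) := by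
    have e := real_inter_openConn_sub_eq μ a₁ a₂ b Q
    have s1 : Q ∩ openConn a₁ b = openConn a₁ b ∩ Q := Set.inter_comm _ _
    have s2 : Q ∩ openConn a₂ b = openConn a₂ b ∩ Q := Set.inter_comm _ _
    have s3 : Q ∩ openConn a₁ b ∩ (openConn a₁ a₂)ᶜ = D ∩ (openConn a₁ b ∩ Q) := by
      ext ω; simp only [hD, Set.mem_inter_iff, Set.mem_compl_iff]; tauto
    have s4 : Q ∩ openConn a₂ b ∩ (openConn a₁ a₂)ᶜ = D ∩ (openConn a₂ b ∩ Q) := by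
      ext ω; simp only [hD, Set.mem_inter_iff, Set.mem_compl_iff]; tauto
    rw [s3, s4, s1, s2] at e
    exact e
  -- chain
  have hDn : 0 ≤ μ.real D := measureReal_nonneg
  have hkey : μ.real D * μ.real (D ∩ (openConn a₁ b ∩ Q)) ≤
      μ.real D * μ.real (D ∩ (openConn a₂ b ∩ Q)) := by
    have hQn : 0 ≤ μ.real (D ∩ Q) := measureReal_nonneg
    nlinarith [hI, hJ, hτ', mul_le_mul_of_nonneg_right hτ' hQn]
  by_cases hD0 : μ.real D = 0
  · have h1' : μ.real (D ∩ (openConn a₁ b ∩ Q)) = 0 :=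
      le_antisymm ((measureReal_mono Set.inter_subset_left).trans hD0.le) measureReal_nonneg
    have h2' : 0 ≤ μ.real (D ∩ (openConn a₂ b ∩ Q)) := measureReal_nonneg
    linarith
  · have hDp : 0 < μ.real D := lt_of_le_of_ne hDn (Ne.symm hD0)
    have := le_of_mul_le_mul_left hkey hDp
    linarith

end SandwichSet

/-! ### Registered stub form -/

open SandwichSet in
/-- **Registered stub `stub_lemma3SandwichSet_sp`** (= `SandwichSet.lemma3_sandwich_set` on `Fin n`): Kozma–Nitzan's
Lemma 3 for every sandwich event of the cluster of an observer SET — the kernel of the two-relay drift theorem.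
[cite: KozmaNitzan2024, Lemma 3 (pp. 6–7)] -/
theorem stub_lemma3SandwichSet_sp : ∀ (n : ℕ) (w : Sym2 (Fin n) → unitInterval) (a₁ a₂ b : Fin n) (O : Finset (Fin n)) (𝓕 : Set (Set (Fin n))), (∀ ω : BondConfig (Fin n), a₂ ∈ (⋃ o ∈ O, openCluster ω o) → a₁ ∉ (⋃ o ∈ O, openCluster ω o) → (⋃ o ∈ O, openCluster ω o) ∈ 𝓕) → (∀ ω : BondConfig (Fin n), (⋃ o ∈ O, openCluster ω o) ∈ 𝓕 → a₁ ∉ (⋃ o ∈ O, openCluster ω o)) → (prodBernoulli w).real (openConn a₁ b) ≤ (prodBernoulli w).real (openConn a₂ b) → (prodBernoulli w).real (openConn a₁ b ∩ {ω | (⋃ o ∈ O, openCluster ω o) ∈ 𝓕}) ≤ (prodBernoulli w).real (openConn a₂ b ∩ {ω | (⋃ o ∈ O, openCluster ω o) ∈ 𝓕}) :=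
  fun _ w a₁ a₂ b O 𝓕 hlo hhi hτ => lemma3_sandwich_set w a₁ a₂ b O 𝓕 hlo hhi hτ

end Summit.CriticalPhenomena.PercolationContinuityZ3.Theorems
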